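/-
Copyright: pub-rosobs cell (Resolution Observatory), carver gen 39.  Companion file; statements OURS, in
the cell's polynomial weighted-centre model `W(f)`.  Instrument — NOT a resolution theorem.
-/
import Literature.AlgebraicGeometry.Resolution.WeightedCentreSecondFace
import Literature.AlgebraicGeometry.Resolution.WeightedCentreGradedAutomorphism
import Mathlib.LinearAlgebra.Matrix.Rank
import HarnessLib

/-!
# Second face with spectator variables

`WeightedCentreSecondFace` excludes the positive-dimensional competitors `(2, 3, …)` of the centre
`(v, w, u, z)` of `f = v² + u w² + z^q` in FOUR variables.  Census germs carry spectator variables: here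
`f = X_i² + X_l X_j² + X_e^q ∈ k[X_1, …, X_N]` with `i, j, l, e` distinct and `N` arbitrary, and we prove
that NO centre `(Ψ, γ)` (any polynomial automorphism `Ψ` fixing the origin) has one weight `1/2`, all
other non-zero weights `1/3`, and at most three non-zero weights
(`not_isCentreFor_umbrellaAddPowIn`); hence `2 :: bs ∉ W(f)` for `bs ∈ {[], [3], [3, 3]}`
(`two_cons_not_mem_admissibleInvariants_umbrellaAddPowIn`, `not_mem_admissibleInvariants_umbrellaAddPowIn`).
The four-variable file is the case `N = 4` (`umbrellaAddPowIn_eq_umbrellaAddPow`); what is NOT proved here: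
point-centre competitors `(2, 3, 3, c)` with `c > q`, and the maximality of `(2, 3, 3, q)`.

Proof.  For every weight-`0` variable `y_d` restrict to the `y_d`-axis of the centre
(`axisHom d ∘ Ψ⁻¹`); the Taylor-coefficient computation of `WeightedCentreSecondFace` gives
`v = w = z = 0` along the axis and `u|_{axis} = a_w² · r` with `a_w(0) = 0`, so the LINEAR coefficient of
`y_d` in each of `Ψ⁻¹ v, Ψ⁻¹ w, Ψ⁻¹ u, Ψ⁻¹ z` vanishes (`coeff_one_axisHom`).  Hence the `4 × N` block
of the Jacobian of `Ψ⁻¹` at the origin with rows `v, w, u, z` is supported on the `≤ 3` columns of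
positive weight; but by `sum_jacobianBlock_symm_mul_jacobianBlock` (the Jacobians of `Ψ⁻¹` and `Ψ`
at the origin are mutually inverse) this block times a `3 × 4` block is the identity `I₄` — impossible
by rank (`Matrix.rank_mul_le_left`).

References: [Temkin2025, §1.2.2 (1) (p. 4)] (the invariant of `v² + u w²`‑type forms and maximal
contact); [AbramovichTemkinWlodarczyk2024, Thm. 5.3.1 (2) (p. 1578), Lemma 5.2.10 (p. 1577)]
(`inv = max`, Jacobian criterion); [CossartJannsenSaito2020, Def. 1.26] (initial forms along a
regular subscheme).  Statements ours (the cell's model); value: typed lemma for census replay — NOT a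
resolution theorem.
-/

open MvPolynomial

namespace Literature.AlgebraicGeometry.Resolution.WeightedBlowup

variable {k : Type*} [Field k] {N : ℕ}

/-! ## §1 Restriction to a coordinate axis -/

section Axis

/-- **Restriction to the `d`-th coordinate axis**: `X_d ↦ T`, `X_m ↦ 0` (`m ≠ d`). (construction,
plumbing) [cite: CossartJannsenSaito2020, Def. 1.26 (restriction to a regular subscheme)] -/
noncomputable def axisHom (d : Fin N) : MvPolynomial (Fin N) k →ₐ[k] Polynomial k :=
  aeval fun m => if m = d then Polynomial.X else 0

/-- The axis map on a variable (plumbing). [cite: CossartJannsenSaito2020, Def. 1.26] -/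
theorem axisHom_X (d m : Fin N) :
    axisHom (k := k) d (X m) = if m = d then Polynomial.X else 0 := by
  rw [axisHom, aeval_X]

/-- The constant coefficient of the axis restriction is the constant coefficient. (derived here)
[cite: CossartJannsenSaito2020, Def. 1.26] -/
theorem coeff_zero_axisHom (d : Fin N) (g : MvPolynomial (Fin N) k) :
    (axisHom d g).coeff 0 = constantCoeff g := by
  have key : (Polynomial.evalRingHom 0).comp (axisHom (k := k) d).toRingHom = constantCoeff := by
    refine ringHom_ext (fun r => ?_) (fun i => ?_)
    · rw [RingHom.comp_apply, AlgHom.toRingHom_eq_coe, RingHom.coe_coe, ← MvPolynomial.algebraMap_eq,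
        AlgHom.commutes, Polynomial.algebraMap_apply, Polynomial.coe_evalRingHom, Polynomial.eval_C,
        MvPolynomial.algebraMap_eq, constantCoeff_C]
      rfl
    · rw [RingHom.comp_apply, AlgHom.toRingHom_eq_coe, RingHom.coe_coe, axisHom_X,
        Polynomial.coe_evalRingHom, constantCoeff_X]
      split_ifs <;> simp
  have := congrArg (fun φ : MvPolynomial (Fin N) k →+* k => φ g) key
  simpa [Polynomial.coeff_zero_eq_eval_zero] using this

/-- **The `T¹`-coefficient of the axis restriction is the linear coefficient of `X_d`.** (derived here)
[cite: AbramovichTemkinWlodarczyk2024, proof of Thm. 5.3.1 (2)–(3) (p. 1578) (the Jacobian at the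
origin)] -/
theorem coeff_one_axisHom (d : Fin N) (g : MvPolynomial (Fin N) k) :
    (axisHom d g).coeff 1 = coeff (Finsupp.single d 1) g := by
  classical
  induction g using MvPolynomial.induction_on with
  | C a =>
    rw [axisHom, algHom_C, Polynomial.algebraMap_apply, Polynomial.coeff_C, if_neg one_ne_zero, coeff_C,
      if_neg (Finsupp.single_ne_zero.2 one_ne_zero).symm]
  | add p q hp hq => rw [map_add, Polynomial.coeff_add, hp, hq, coeff_add]
  | mul_X p n hp =>
    rw [map_mul, axisHom_X, coeff_mul_X']
    by_cases hnd : n = d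
    · subst hnd
      rw [if_pos rfl, Polynomial.coeff_mul_X, coeff_zero_axisHom, if_pos (by simp), tsub_self,
        ← constantCoeff_eq]
    · have hns : n ∉ (Finsupp.single d 1).support := fun h =>
        hnd ((Finsupp.mem_support_single _ _ _).1 h).1
      rw [if_neg hnd, mul_zero, Polynomial.coeff_zero, if_neg hns]

end Axis

/-! ## §2 The second face with spectators -/

section SecondFaceSpectators

variable (k)

/-- `X_i² + X_l X_j² + X_e^q` in `N` variables (the Whitney umbrella plus a power, with spectators).
(construction) [cite: Temkin2025, §1.2.2 (1) (p. 4)] -/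
noncomputable def umbrellaAddPowIn (i j l e : Fin N) (q : ℕ) : MvPolynomial (Fin N) k :=
  X i ^ 2 + X l * X j ^ 2 + X e ^ q

variable {k}

/-- **Second face with spectators, weight form.**  For `f = X_i² + X_l X_j² + X_e^q` (`i, j, l, e`
distinct, `q` invertible in `k`, `q ≥ 2`) there is NO centre `(Ψ, γ)` — `Ψ` ANY polynomial automorphism
fixing the origin — with `γ a = 1/2`, every other non-zero weight `1/3`, and at most three non-zero
weights.  (Along each weight-`0` axis of such a centre `v, w, z` vanish and `u` is a square times a unit,
so the rows `v, w, u, z` of the Jacobian of `Ψ⁻¹` at `0` live on `≤ 3` columns, contradicting the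
invertibility of the Jacobian.) (derived here) [cite: Temkin2025, §1.2.2 (1) (p. 4);
AbramovichTemkinWlodarczyk2024, Thm. 5.3.1 (2) (p. 1578), Lemma 5.2.10 (p. 1577);
CossartJannsenSaito2020, Def. 1.26] -/
theorem not_isCentreFor_umbrellaAddPowIn {i j l e : Fin N} (hij : i ≠ j) (hil : i ≠ l) (hie : i ≠ e)
    (hjl : j ≠ l) (hje : j ≠ e) (hle : l ≠ e) {q : ℕ} (hqk : (q : k) ≠ 0) (hq2 : 2 ≤ q)
    {Ψ : MvPolynomial (Fin N) k ≃ₐ[k] MvPolynomial (Fin N) k} {γ : Fin N → ℚ} {a : Fin N}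
    (hγa : γ a = 1 / 2) (hthird : ∀ m, m ≠ a → γ m ≠ 0 → γ m = 1 / 3)
    (hS3 : (Finset.univ.filter fun m => γ m ≠ 0).card ≤ 3) :
    ¬ IsCentreFor (umbrellaAddPowIn k i j l e q) Ψ γ := by
  classical
  intro hc
  set f := umbrellaAddPowIn k i j l e q with hf
  set g := Ψ.symm f with hg
  have hfg : f = Ψ g := by rw [hg, AlgEquiv.apply_symm_apply]
  set S := Finset.univ.filter (fun m : Fin N => γ m ≠ 0) with hS
  have haS : a ∈ S := Finset.mem_filter.2 ⟨Finset.mem_univ _, by rw [hγa]; norm_num⟩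
  -- (J) admissibility of the centre, read on the monomials of `g = Ψ⁻¹ f`
  have hJ : ∀ m ∈ g.support, 2 ≤ ∑ x ∈ S, m x ∧ (2 ≤ m a ∨ 3 ≤ ∑ x ∈ S, m x) := by
    intro m hm
    have h1 : (1 : ℚ) ≤ monomialValuation γ m := hc.2.2 m hm
    have hv : monomialValuation γ m = ∑ x ∈ S, (m x : ℚ) * γ x := by
      rw [monomialValuation, Finsupp.sum_fintype _ _ (fun x => by simp),
        ← Finset.sum_filter_add_sum_filter_not Finset.univ (fun x => γ x ≠ 0),
        Finset.sum_eq_zero (s := Finset.univ.filter fun x => ¬ γ x ≠ 0) (fun x hx => ?_), add_zero]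
      have : γ x = 0 := by simpa using (Finset.mem_filter.1 hx).2
      rw [this, mul_zero]
    have hsplit : ∑ x ∈ S, (m x : ℚ) * γ x =
        (m a : ℚ) * (1 / 2) + ∑ x ∈ S.erase a, (m x : ℚ) * (1 / 3) := by
      rw [← Finset.add_sum_erase S _ haS, hγa]
      congr 1
      refine Finset.sum_congr rfl fun x hx => ?_
      rw [hthird x (Finset.ne_of_mem_erase hx) (Finset.mem_filter.1 (Finset.mem_of_mem_erase hx)).2]
    have hsumS : (∑ x ∈ S, (m x : ℚ)) = (m a : ℚ) + ∑ x ∈ S.erase a, (m x : ℚ) :=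
      (Finset.add_sum_erase S _ haS).symm
    have hma : m a ≤ ∑ x ∈ S, m x :=
      Finset.single_le_sum (f := fun x => m x) (fun x _ => Nat.zero_le _) haS
    have key : (6 : ℚ) ≤ 2 * ((∑ x ∈ S, m x : ℕ) : ℚ) + (m a : ℕ) := by
      rw [Nat.cast_sum, hsumS]
      rw [hv, hsplit, ← Finset.sum_mul] at h1
      linarith
    have key' : 6 ≤ 2 * (∑ x ∈ S, m x) + m a := by exact_mod_cast key
    omega
  -- second order: split g = X_a² · A + B, B of S-degree ≥ 3 on every monomial
  set A := MvPolynomial.divMonomial g (Finsupp.single a 2) with hA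
  set B := MvPolynomial.modMonomial g (Finsupp.single a 2) with hB
  have hgAB : g = X a ^ 2 * A + B := by
    rw [X_pow_eq_monomial]; exact (divMonomial_add_modMonomial g _).symm
  have hB3 : ∀ m ∈ B.support, 3 ≤ ∑ x ∈ S, m x := by
    intro m hm
    rw [mem_support_iff] at hm
    have hnot : ¬ Finsupp.single a 2 ≤ m := fun hle' => hm (coeff_modMonomial_of_le g hle')
    rw [coeff_modMonomial_of_not_le g hnot] at hm
    have hma : m a < 2 := by rw [Finsupp.single_le_iff] at hnot; omega
    rcases (hJ m (mem_support_iff.2 hm)).2 with h2 | h3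
    · omega
    · exact h3
  have hfAB : f = Ψ (X a) ^ 2 * Ψ A + Ψ B := by
    rw [hfg, hgAB, map_add, map_mul, map_pow]
  -- (L) along every weight-0 axis, the linear coefficients of Ψ⁻¹ v, Ψ⁻¹ w, Ψ⁻¹ u, Ψ⁻¹ z vanish
  have hoff : ∀ d, γ d = 0 → ∀ x, (x = i ∨ x = j ∨ x = l ∨ x = e) →
      coeff (Finsupp.single d 1) (Ψ.symm (X x)) = 0 := by
    intro d hγd
    -- the restriction to the `y_d`-axis of the centre: ρ = axis_d ∘ Ψ⁻¹
    obtain ⟨ρ, hρ⟩ : ∃ ρ : MvPolynomial (Fin N) k →ₐ[k] Polynomial k, ∀ p, ρ p = axisHom d (Ψ.symm p) :=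
      ⟨(axisHom d).comp (Ψ.symm : MvPolynomial (Fin N) k →ₐ[k] MvPolynomial (Fin N) k), fun p => rfl⟩
    have hρΨ : ∀ m, ρ (Ψ (X m)) = if m = d then Polynomial.X else (0 : Polynomial k) := by
      intro m; rw [hρ, AlgEquiv.symm_apply_apply, axisHom_X]
    have hρS : ∀ m ∈ S, ρ (Ψ.toAlgHom (X m)) = 0 := by
      intro m hm
      have hmd : m ≠ d := by
        rintro rfl; exact (Finset.mem_filter.1 hm).2 hγd
      rw [AlgEquiv.toAlgHom_apply, hρΨ, if_neg hmd]
    have hρ0 : ∀ m, (ρ (X m)).coeff 0 = 0 := by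
      intro m; rw [hρ, coeff_zero_axisHom]; exact constantCoeff_symm_X_eq_zero_of_forall Ψ hc.1 m
    have hρ1 : ∀ m, (ρ (X m)).coeff 1 = coeff (Finsupp.single d 1) (Ψ.symm (X m)) := by
      intro m; rw [hρ, coeff_one_axisHom]
    -- Taylor expansions of f: explicit form
    have hT : ∀ x, taylorHom ρ x f =
        (Polynomial.C (ρ (X i)) + if i = x then Polynomial.X else 0) ^ 2
        + (Polynomial.C (ρ (X l)) + if l = x then Polynomial.X else 0) *
          (Polynomial.C (ρ (X j)) + if j = x then Polynomial.X else 0) ^ 2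
        + (Polynomial.C (ρ (X e)) + if e = x then Polynomial.X else 0) ^ q := by
      intro x
      simp only [hf, umbrellaAddPowIn, map_add, map_mul, map_pow, taylorHom_X]
    -- order ≥ 2 along the centre: the ε⁰ and ε¹ coefficients vanish
    have hdvd2 : ∀ x, Polynomial.X ^ 2 ∣ taylorHom ρ x f := by
      intro x
      rw [hfg]
      exact X_pow_dvd_taylorHom ρ x Ψ.toAlgHom S hρS g fun m hm => (hJ m hm).1
    have hc0 : ∀ x, (taylorHom ρ x f).coeff 0 = 0 := fun x => by
      obtain ⟨r, hr⟩ := hdvd2 x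
      rw [hr, Polynomial.coeff_X_pow_mul', if_neg (by norm_num)]
    have hc1 : ∀ x, (taylorHom ρ x f).coeff 1 = 0 := fun x => by
      obtain ⟨r, hr⟩ := hdvd2 x
      rw [hr, Polynomial.coeff_X_pow_mul', if_neg (by norm_num)]
    -- (D1) ρ(w) = 0 from the ε¹-coefficient in the direction u
    have hw0 : ρ (X j) = 0 := by
      have h := hc1 l
      rw [hT l] at h
      simp only [if_neg hil, if_neg hjl, if_neg (Ne.symm hle), if_true, add_zero] at h
      have eq1 : (Polynomial.C (ρ (X i))) ^ 2 + (Polynomial.C (ρ (X l)) + Polynomial.X) *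
          (Polynomial.C (ρ (X j))) ^ 2 + (Polynomial.C (ρ (X e))) ^ q
          = Polynomial.C (ρ (X i) ^ 2 + ρ (X l) * ρ (X j) ^ 2 + ρ (X e) ^ q)
            + Polynomial.C (ρ (X j) ^ 2) * Polynomial.X := by
        simp only [map_add, map_mul, map_pow]; ring
      rw [eq1, Polynomial.coeff_add, Polynomial.coeff_C, if_neg (by norm_num), Polynomial.coeff_C_mul_X,
        if_pos rfl, zero_add] at h
      exact (pow_eq_zero_iff two_ne_zero).1 h
    -- (D2) ρ(z) = 0 from the ε¹-coefficient in the direction z (`q` invertible)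
    have hz0 : ρ (X e) = 0 := by
      have h := hc1 e
      rw [hT e] at h
      simp only [if_neg hie, if_neg hle, if_neg hje, if_true, add_zero] at h
      have eq1 : (Polynomial.C (ρ (X i))) ^ 2 + Polynomial.C (ρ (X l)) * (Polynomial.C (ρ (X j))) ^ 2
          = Polynomial.C (ρ (X i) ^ 2 + ρ (X l) * ρ (X j) ^ 2) := by
        simp only [map_add, map_mul, map_pow]
      rw [eq1, Polynomial.coeff_add, Polynomial.coeff_C, if_neg (by norm_num), zero_add,
        add_comm (Polynomial.C _), Polynomial.coeff_X_add_C_pow, Nat.choose_one_right] at h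
      have hqne : (q : Polynomial k) ≠ 0 := by
        rw [← Polynomial.C_eq_natCast]; exact Polynomial.C_ne_zero.2 hqk
      exact (pow_eq_zero_iff (by omega)).1 ((mul_eq_zero.1 h).resolve_right hqne)
    -- (D3) ρ(f) = 0, hence ρ(v) = 0
    have hρf : ρ f = 0 := by
      rw [← eval_zero_taylorHom ρ i, ← Polynomial.coeff_zero_eq_eval_zero]; exact hc0 i
    have hv0 : ρ (X i) = 0 := by
      have h : ρ (X i) ^ 2 + ρ (X l) * ρ (X j) ^ 2 + ρ (X e) ^ q = 0 := by
        simpa only [hf, umbrellaAddPowIn, map_add, map_mul, map_pow] using hρf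
      rw [hw0, hz0, zero_pow two_ne_zero, mul_zero, add_zero, zero_pow (by omega), add_zero] at h
      exact (pow_eq_zero_iff two_ne_zero).1 h
    -- (D4) the ε²-coefficients: `a_x² · ρ(Ψ A)`
    have hc2 : ∀ x, ∃ ax : Polynomial k, (taylorHom ρ x f).coeff 2 = ax ^ 2 * ρ (Ψ A) := by
      intro x
      obtain ⟨η, hη⟩ := X_dvd_taylorHom ρ x (hρS a haS)
      rw [AlgEquiv.toAlgHom_apply] at hη
      refine ⟨η.eval 0, ?_⟩
      have hB0 : (taylorHom ρ x (Ψ B)).coeff 2 = 0 := by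
        obtain ⟨r, hr⟩ := X_pow_dvd_taylorHom ρ x Ψ.toAlgHom S hρS B hB3
        rw [AlgEquiv.toAlgHom_apply] at hr
        rw [hr, Polynomial.coeff_X_pow_mul', if_neg (by norm_num)]
      have e2 : (Polynomial.X * η) ^ 2 * taylorHom ρ x (Ψ A) =
          Polynomial.X ^ 2 * (η ^ 2 * taylorHom ρ x (Ψ A)) := by ring
      rw [hfAB, map_add, map_mul, map_pow, Polynomial.coeff_add, hB0, add_zero, hη, e2,
        Polynomial.coeff_X_pow_mul', if_pos le_rfl, Nat.sub_self, Polynomial.coeff_zero_eq_eval_zero,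
        Polynomial.eval_mul, Polynomial.eval_pow, eval_zero_taylorHom]
    -- (D5) the same coefficients, computed directly: 1 in the direction v, ρ(u) in the direction w
    have hcv : (taylorHom ρ i f).coeff 2 = 1 := by
      rw [hT i, hv0, hw0, hz0, map_zero]
      simp only [if_true, if_neg (Ne.symm hil), if_neg (Ne.symm hij), if_neg (Ne.symm hie), add_zero,
        zero_add, zero_pow two_ne_zero, mul_zero, zero_pow (show q ≠ 0 by omega), Polynomial.coeff_X_pow]
    have hcw : (taylorHom ρ j f).coeff 2 = ρ (X l) := by
      rw [hT j, hv0, hw0, hz0, map_zero]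
      simp only [if_true, if_neg hij, if_neg (Ne.symm hjl), if_neg (Ne.symm hje), add_zero, zero_add,
        zero_pow two_ne_zero, zero_pow (show q ≠ 0 by omega), Polynomial.coeff_C_mul,
        Polynomial.coeff_X_pow, mul_one]
    obtain ⟨av, hav⟩ := hc2 i
    obtain ⟨aw, haw⟩ := hc2 j
    rw [hcv] at hav
    rw [hcw] at haw
    -- (D6) `1 = a_v² r` and `ρ(u) = a_w² r` with `ρ(u)(0) = 0`: `a_w(0) = 0`, so `T² ∣ ρ(u)`
    have hr0 : (ρ (Ψ A)).eval 0 ≠ 0 := by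
      intro h0
      have h := congrArg (Polynomial.eval 0) hav
      rw [Polynomial.eval_one, Polynomial.eval_mul, h0, mul_zero] at h
      exact one_ne_zero h
    have haw0 : aw.eval 0 = 0 := by
      have h := congrArg (Polynomial.eval 0) haw
      rw [← Polynomial.coeff_zero_eq_eval_zero, hρ0 l, Polynomial.eval_mul, Polynomial.eval_pow] at h
      exact (pow_eq_zero_iff two_ne_zero).1 ((mul_eq_zero.1 h.symm).resolve_right hr0)
    have hu1 : (ρ (X l)).coeff 1 = 0 := by
      obtain ⟨b, hb⟩ : Polynomial.X ∣ aw :=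
        Polynomial.X_dvd_iff.2 (by rwa [Polynomial.coeff_zero_eq_eval_zero])
      have e2 : ρ (X l) = Polynomial.X ^ 2 * (b ^ 2 * ρ (Ψ A)) := by rw [haw, hb]; ring
      rw [e2, Polynomial.coeff_X_pow_mul', if_neg (by norm_num)]
    -- conclusion for the four active variables
    intro x hx
    rw [← hρ1]
    rcases hx with rfl | rfl | rfl | rfl
    · rw [hv0, Polynomial.coeff_zero]
    · rw [hw0, Polynomial.coeff_zero]
    · exact hu1
    · rw [hz0, Polynomial.coeff_zero]
  -- (M) the Jacobian blocks: rows v, w, u, z of `∂(Ψ⁻¹X)/∂X(0)` are supported on the columns `S`, and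
  -- multiply the `S × {v,w,u,z}` block of `∂(ΨX)/∂X(0)` to the identity — rank contradiction.
  have hmon : ∀ m, (((fun _ => 1 : Fin N → ℕ) m : ℕ) : ℕ∞) ≤ monomialOrd (fun _ => 1) (Ψ (X m)) :=
    fun m => by
      rw [Nat.cast_one]
      exact one_le_monomialOrd_one_of_constantCoeff_eq_zero _ (hc.1 m)
  set F : Finset (Fin N) := {i, j, l, e} with hF
  have hFmem : ∀ x ∈ F, x = i ∨ x = j ∨ x = l ∨ x = e := by
    intro x hx
    simpa only [hF, Finset.mem_insert, Finset.mem_singleton] using hx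
  have hFcard : F.card = 4 := by
    rw [hF, Finset.card_insert_of_notMem (by simp [hij, hil, hie]),
      Finset.card_insert_of_notMem (by simp [hjl, hje]), Finset.card_pair hle]
  have hentry : ∀ x ∈ F, ∀ y : Fin N,
      ∑ s ∈ S, coeff (Finsupp.single s 1) (Ψ.symm (X x)) * coeff (Finsupp.single y 1) (Ψ (X s)) =
        if x = y then 1 else 0 := by
    intro x hx y
    rw [Finset.sum_subset (Finset.subset_univ S) (fun s _ hs => by
      have hγs : γ s = 0 := by simpa [hS] using hs
      rw [hoff s hγs x (hFmem x hx), zero_mul])]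
    have key := sum_jacobianBlock_symm_mul_jacobianBlock (fun _ : Fin N => (1 : ℕ))
      (fun _ => Nat.one_pos) Ψ hmon (i := x) (l := y) rfl
    rwa [Finset.filter_true_of_mem (fun _ _ => rfl)] at key
  let P : Matrix F S k := Matrix.of fun x s =>
    coeff (Finsupp.single (s : Fin N) 1) (Ψ.symm (X (x : Fin N)))
  let Q : Matrix S F k := Matrix.of fun s y =>
    coeff (Finsupp.single (y : Fin N) 1) (Ψ (X (s : Fin N)))
  have hPQ : P * Q = 1 := by
    ext x y
    rw [Matrix.mul_apply, Matrix.one_apply]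
    have h := hentry x x.2 y
    rw [← Finset.sum_coe_sort S] at h
    simp only [P, Q, Matrix.of_apply]
    rw [h]
    simp only [Subtype.ext_iff]
  have h1 : (1 : Matrix F F k).rank = 4 := by
    rw [Matrix.rank_one, Fintype.card_coe, hFcard]
  have h2 : (P * Q).rank ≤ 3 :=
    (Matrix.rank_mul_le_left P Q).trans ((Matrix.rank_le_card_width P).trans
      (by rw [Fintype.card_coe]; exact hS3))
  rw [hPQ, h1] at h2
  omega

/-- The four-variable model of `WeightedCentreSecondFace` is the case `N = 4`, `(i,j,l,e) = (0,1,2,3)`.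
(plumbing) [cite: Temkin2025, §1.2.2 (1) (p. 4)] -/
theorem umbrellaAddPowIn_eq_umbrellaAddPow (q : ℕ) :
    umbrellaAddPowIn k (0 : Fin 4) 1 2 3 q = umbrellaAddPow k q := rfl

/-- The length of `exps γ` is the number of non-zero weights (plumbing). [folklore] -/
private theorem length_exps_eq_card (γ : Fin N → ℚ) :
    (exps γ).length = (Finset.univ.filter fun m => γ m ≠ 0).card := by
  classical
  unfold exps
  rw [List.length_insertionSort, List.length_map, Finset.length_toList]

/-- Four distinct indices need `4 ≤ N` (plumbing). [folklore] -/
private theorem four_le_of_ne {i j l e : Fin N} (hij : i ≠ j) (hil : i ≠ l) (hie : i ≠ e)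
    (hjl : j ≠ l) (hje : j ≠ e) (hle : l ≠ e) : 4 ≤ N := by
  classical
  have h : ({i, j, l, e} : Finset (Fin N)).card = 4 := by
    rw [Finset.card_insert_of_notMem (by simp [hij, hil, hie]),
      Finset.card_insert_of_notMem (by simp [hjl, hje]), Finset.card_pair hle]
  have := Finset.card_le_univ ({i, j, l, e} : Finset (Fin N))
  rwa [h, Fintype.card_fin] at this

/-- **`2 :: bs ∉ W(X_i² + X_l X_j² + X_e^q)` for `bs ∈ {[], [3], [3,3]}`, with spectators**: no
positive-dimensional centre of a germ with this normal form reaches `(2, 3, …)` (`q` invertible in `k`,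
`q ≥ 2`; any number `N ≥ 4` of variables). (derived here) [cite: Temkin2025, §1.2.2 (1) (p. 4);
AbramovichTemkinWlodarczyk2024, Thm. 5.3.1 (2) (p. 1578)] -/
theorem two_cons_not_mem_admissibleInvariants_umbrellaAddPowIn {i j l e : Fin N} (hij : i ≠ j)
    (hil : i ≠ l) (hie : i ≠ e) (hjl : j ≠ l) (hje : j ≠ e) (hle : l ≠ e) {q : ℕ} (hqk : (q : k) ≠ 0)
    (hq2 : 2 ≤ q) {bs : List ℚ} (hbs : ∀ x ∈ bs, x = 3) (hlen : bs.length < 3) :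
    (2 : ℚ) :: bs ∉ admissibleInvariants (umbrellaAddPowIn k i j l e q) := by
  rintro ⟨Ψ, γ, hc, hexps⟩
  have hN := four_le_of_ne hij hil hie hjl hje hle
  obtain ⟨a, -, hγa, -, hthird⟩ := weights_of_exps_eq_two_cons hexps hbs (by omega)
  have hS3 : (Finset.univ.filter fun m => γ m ≠ 0).card ≤ 3 := by
    rw [← length_exps_eq_card, hexps, List.length_cons]; omega
  exact not_isCentreFor_umbrellaAddPowIn hij hil hie hjl hje hle hqk hq2 hγa hthird hS3 hc

/-- **Second face with spectators: `(2,3,3), (2,3), (2) ∉ W(X_i² + X_l X_j² + X_e^q)`** (`q` invertible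
in `k`, `q ≥ 2`, `i, j, l, e` distinct, any `N`). (derived here) [cite: Temkin2025, §1.2.2 (1) (p. 4);
AbramovichTemkinWlodarczyk2024, Thm. 5.3.1 (2) (p. 1578)] -/
theorem not_mem_admissibleInvariants_umbrellaAddPowIn_of_ne_zero {i j l e : Fin N} (hij : i ≠ j)
    (hil : i ≠ l) (hie : i ≠ e) (hjl : j ≠ l) (hje : j ≠ e) (hle : l ≠ e) {q : ℕ} (hqk : (q : k) ≠ 0)
    (hq2 : 2 ≤ q) :
    [(2 : ℚ), 3, 3] ∉ admissibleInvariants (umbrellaAddPowIn k i j l e q) ∧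
      [(2 : ℚ), 3] ∉ admissibleInvariants (umbrellaAddPowIn k i j l e q) ∧
      [(2 : ℚ)] ∉ admissibleInvariants (umbrellaAddPowIn k i j l e q) :=
  ⟨two_cons_not_mem_admissibleInvariants_umbrellaAddPowIn hij hil hie hjl hje hle hqk hq2 (bs := [3, 3])
      (by simp) (by decide),
    two_cons_not_mem_admissibleInvariants_umbrellaAddPowIn hij hil hie hjl hje hle hqk hq2 (bs := [3])
      (by simp) (by decide),
    two_cons_not_mem_admissibleInvariants_umbrellaAddPowIn hij hil hie hjl hje hle hqk hq2 (bs := [])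
      (by simp) (by decide)⟩

/-- **The census shape with spectators (characteristic 2, `q` odd, `q ≥ 3`): `(2,3,3) ∉ W`** for
`X_i² + X_l X_j² + X_e^q` in any number of variables. (derived here) [cite: Temkin2025, §1.2.2 (1)
(p. 4); AbramovichTemkinWlodarczyk2024, Thm. 5.3.1 (2) (p. 1578)] -/
theorem not_mem_admissibleInvariants_umbrellaAddPowIn [CharP k 2] {i j l e : Fin N} (hij : i ≠ j)
    (hil : i ≠ l) (hie : i ≠ e) (hjl : j ≠ l) (hje : j ≠ e) (hle : l ≠ e) {q : ℕ} (hq : Odd q)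
    (hq3 : 3 ≤ q) : [(2 : ℚ), 3, 3] ∉ admissibleInvariants (umbrellaAddPowIn k i j l e q) := by
  refine (not_mem_admissibleInvariants_umbrellaAddPowIn_of_ne_zero hij hil hie hjl hje hle
    (fun h => ?_) (by omega)).1
  obtain ⟨r, rfl⟩ := hq
  rw [Nat.cast_add, Nat.cast_mul, Nat.cast_two, CharTwo.two_eq_zero, zero_mul, zero_add,
    Nat.cast_one] at h
  exact one_ne_zero h

end SecondFaceSpectators

end Literature.AlgebraicGeometry.Resolution.WeightedBlowup
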